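import Literature.Geometry.Symplectic.JHolomorphicLocalIntersections
import Literature.Geometry.Symplectic.JHolomorphicFlatUniqueContinuation
import Summits.SmoothPoincare4.SmoothPoincare4.Theorems.SullivanDualWitnessChargeHelperJHolomorphicChart
import Summits.SmoothPoincare4.SmoothPoincare4.Theorems.SullivanDualWitnessChargeHelperChartJ
import Summits.SmoothPoincare4.SmoothPoincare4.Theorems.SullivanDualWitnessChargeHelperInTangentCoordinatesContMDiffOn
import Mathlib.Topology.LocallyConstant.Basic

/-!
# Fact F1 (unique continuation from an open set for `J`-curves) from its FLAT form

Crux `WitnessCharge` (stmt-SmoothPoincare4-7824), line `Sketch`, continuation lead c5 (cycle 5).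
`Literature.Geometry.Symplectic.jHolomorphic_uniqueContinuation_const` (fact F1 of
`JHolomorphicLocalIntersections.lean`, one of the five local inputs of McDuff's limit theorem L1b)
is PROVED from the chart-free named fact
`Literature.Geometry.Symplectic.jHolomorphicFlat_uniqueContinuation_const` (McDuff 1991
Lemma 2.3 in coordinates = Aronszajn 1957 / Carleman 1939: a flat `Jc`-holomorphic `C^∞` map of a
disc into an open set of `ℝ⁴` which is constant near one point is constant on the disc):
`jHolomorphic_uniqueContinuation_const_of_flat` (registered helper). The locus `S ⊆ ℂ` where the
entire `J`-curve `G` is locally constant is open; at `z₁ ∈ closure S` the chart expression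
`extChartAt x₁ ∘ G` (`x₁ = G z₁`) on a small disc is a flat `Jc`-holomorphic curve for the flat
structure `Jc` of `helper_chartJ` (`helper_jHolomorphic_chart`, smoothness of the frame expression
of `J` by `helper_inTangentCoordinates_contMDiffOn`), locally constant at a point of `S` in the
disc, hence constant on the disc by the flat fact, so `G` is (the chart is injective on its
source) and `z₁ ∈ S`; `S` is clopen and non-empty in the connected `ℂ`, and a locally constant map
on `ℂ` is constant. So the debt under F1 is a first-order elliptic unique-continuation statement
in two real variables with no manifold or curve vocabulary.
-/

noncomputable section

set_option linter.dupNamespace false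

open scoped Manifold ContDiff Topology
open Set Filter

namespace Summit.SmoothPoincare4.SmoothPoincare4.Theorems.WitnessCharge.PencilIncompleteness

open Literature.Geometry.Symplectic

/-- **F1 from its flat form (registered helper).** GIVEN unique continuation from an open set for
flat `J`-holomorphic curves in `ℝ⁴` (`jHolomorphicFlat_uniqueContinuation_const`: McDuff 1991
Lemma 2.3 in coordinates, Aronszajn / Carleman), the manifold statement
`jHolomorphic_uniqueContinuation_const` (fact F1 of `JHolomorphicLocalIntersections.lean`) holds:
the locus `S` of points where `G` is locally constant is open by definition and closed by the flat
fact applied in a chart at `G z₁`, `z₁ ∈ closure S` (chart localisation `helper_jHolomorphic_chart`,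
flat structure `helper_chartJ`, smoothness `helper_inTangentCoordinates_contMDiffOn`; the chart is
injective on its source), hence all of `ℂ`; a locally constant map on the connected `ℂ` is
constant. -/
theorem jHolomorphic_uniqueContinuation_const_of_flat :
    Literature.Geometry.Symplectic.jHolomorphicFlat_uniqueContinuation_const →
    Literature.Geometry.Symplectic.jHolomorphic_uniqueContinuation_const := by
  intro hflat V _ _ _ _ _ J hJ2 hJs G hGs hGJ z₀ hz₀
  set S : Set ℂ := {z | ∀ᶠ w in 𝓝 z, G w = G z} with hSdef
  have hSopen : IsOpen S := by
    rw [isOpen_iff_mem_nhds]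
    intro z hz
    have h2 : ∀ᶠ w in 𝓝 z, ∀ᶠ v in 𝓝 w, G v = G z := hz.eventually_nhds
    filter_upwards [hz, h2] with w hw1 hw2
    exact hw2.mono fun v hv => by rw [hv, hw1]
  have hSclosed : IsClosed S := by
    rw [← closure_subset_iff_isClosed]
    intro z₁ hz₁
    set x₁ : V := G z₁ with hx₁
    obtain ⟨Jc, hJc_smooth, hJc_sq, hJc_eq⟩ :=
      helper_chartJ V J hJ2 (helper_inTangentCoordinates_contMDiffOn V J hJs) x₁
    -- a disc around `z₁` mapped into the chart source at `x₁`
    have hsrc : (chartAt (EuclideanSpace ℝ (Fin 4)) x₁).source ∈ 𝓝 (G z₁) :=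
      (chartAt (EuclideanSpace ℝ (Fin 4)) x₁).open_source.mem_nhds
        (mem_chart_source (EuclideanSpace ℝ (Fin 4)) x₁)
    have hpre : G ⁻¹' (chartAt (EuclideanSpace ℝ (Fin 4)) x₁).source ∈ 𝓝 z₁ :=
      hGs.continuous.continuousAt hsrc
    obtain ⟨r, hr, hball⟩ := Metric.mem_nhds_iff.1 hpre
    -- the chart expression
    set uc : ℂ → EuclideanSpace ℝ (Fin 4) := fun w => extChartAt (𝓡 4) x₁ (G w) with huc
    have huc_smooth : ContDiffOn ℝ ∞ uc (Metric.ball z₁ r) := by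
      have h1 : ContMDiffOn 𝓘(ℝ, ℂ) 𝓘(ℝ, EuclideanSpace ℝ (Fin 4)) ∞ uc (Metric.ball z₁ r) :=
        (contMDiffOn_extChartAt (I := 𝓡 4) (n := ∞) (x := x₁)).comp hGs.contMDiffOn
          (fun w hw => hball hw)
      exact contMDiffOn_iff_contDiffOn.1 h1
    have huc_maps : Set.MapsTo uc (Metric.ball z₁ r) (extChartAt (𝓡 4) x₁).target := by
      intro w hw
      refine (extChartAt (𝓡 4) x₁).map_source ?_
      rw [extChartAt_source]
      exact hball hw
    have huc_hol : ∀ w ∈ Metric.ball z₁ r, ∀ ζ : ℂ,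
        fderiv ℝ uc w (Complex.I * ζ) = Jc (uc w) (fderiv ℝ uc w ζ) := by
      intro w hw ζ
      have hsrcw : G w ∈ (chartAt (EuclideanSpace ℝ (Fin 4)) x₁).source := hball hw
      rw [huc, hJc_eq (G w) hsrcw]
      exact helper_jHolomorphic_chart V J x₁ G w (hGs w) (hGJ w) hsrcw ζ
    -- a locally-constant point inside the disc
    obtain ⟨z₂, hz₂S, hz₂ball⟩ : ∃ z₂, z₂ ∈ S ∧ z₂ ∈ Metric.ball z₁ r := by
      obtain ⟨z₂, hz₂⟩ := mem_closure_iff_nhds.1 hz₁ (Metric.ball z₁ r) (Metric.ball_mem_nhds _ hr)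
      exact ⟨z₂, hz₂.2, hz₂.1⟩
    have huc_lc : ∀ᶠ w in 𝓝 z₂, uc w = uc z₂ :=
      hz₂S.mono fun w hw => by simp only [huc, hw]
    have hconst := hflat _ (isOpen_extChartAt_target (I := 𝓡 4) x₁) Jc hJc_smooth hJc_sq z₁ r hr
      uc huc_smooth huc_maps huc_hol z₂ hz₂ball huc_lc
    -- `G` is constant on the disc
    have hGconst : ∀ w ∈ Metric.ball z₁ r, G w = G z₂ := by
      intro w hw
      have h := hconst w hw
      refine (extChartAt (𝓡 4) x₁).injOn ?_ ?_ h
      · rw [extChartAt_source]; exact hball hw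
      · rw [extChartAt_source]; exact hball hz₂ball
    show ∀ᶠ w in 𝓝 z₁, G w = G z₁
    have h1 : G z₁ = G z₂ := hGconst z₁ (Metric.mem_ball_self hr)
    filter_upwards [Metric.ball_mem_nhds z₁ hr] with w hw
    rw [hGconst w hw, h1]
  have hSuniv : S = univ := IsClopen.eq_univ ⟨hSclosed, hSopen⟩ ⟨z₀, hz₀⟩
  have hlc : IsLocallyConstant G := by
    rw [IsLocallyConstant.iff_eventually_eq]
    intro z
    have : z ∈ S := by rw [hSuniv]; exact mem_univ z
    exact this
  intro z
  exact hlc.apply_eq_of_isPreconnected isPreconnected_univ (mem_univ z) (mem_univ z₀)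

end Summit.SmoothPoincare4.SmoothPoincare4.Theorems.WitnessCharge.PencilIncompleteness
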